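import Mathlib

/-!
# Crux `GappedShellCensus.FiveFoldRationingR` (stmt-AtomisticToContinuum-18071), line `Sketch` —
# stub `stub_ffrTwoPoles` (no branching: two poles per five-site)

Let `Y ⊆ ℝ³` be all-gapped-twelve at scale `a`, and suppose the bond graph of every twelve-shell
(bonded = distance `≤ a (1 + 1/50)`) is, under a labelling `e : Fin 12 → shell`, one of three explicit
graphs: the cuboctahedron (fcc), the anticuboctahedron (hcp) or the bicapped pentagonal prism (dec).
For a shell point `v = e k` the common bonded neighbours of `y` and `v` are exactly the shell points
bonded to `v`, i.e. `e '' {m ≠ k | m ~ k}`, so their number is the degree of `k` in the edge list.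
The cuboctahedron and the anticuboctahedron are `4`-regular, so no bond at `y` has `≥ 5` common
partners; in the prism graph exactly the two poles `0` and `11` have degree `5`, all other labels have
degree `4`, so the five-bonds at `y` are `{e 0, e 11}`, a set with two elements.
-/

noncomputable section

namespace Summit.AtomisticToContinuum.Crystallization.Theorems

/-- The cuboctahedron (fcc shell bond graph, edge list `L` of pairs `(i, j)` with `i < j`) is `4`-regular:
no label `k : Fin 12` has `≥ 5` neighbours. -/
theorem ffrTP_deg_fcc (L : List (ℕ × ℕ))
    (hL : L = [(0, 4), (0, 5), (0, 8), (0, 9), (1, 4), (1, 5), (1, 10), (1, 11), (2, 6), (2, 7),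
      (2, 8), (2, 9), (3, 6), (3, 7), (3, 10), (3, 11), (4, 8), (4, 10), (5, 9), (5, 11),
      (6, 8), (6, 10), (7, 9), (7, 11)]) :
    ∀ k : Fin 12, ¬ 5 ≤ (Finset.univ.filter (fun m : Fin 12 =>
      m ≠ k ∧ ((k < m ∧ (k.val, m.val) ∈ L) ∨ (m < k ∧ (m.val, k.val) ∈ L)))).card := by
  subst hL
  decide

/-- The anticuboctahedron (hcp shell bond graph) is `4`-regular: no label `k : Fin 12` has `≥ 5`
neighbours. -/
theorem ffrTP_deg_hcp (L : List (ℕ × ℕ))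
    (hL : L = [(0, 2), (0, 5), (0, 7), (0, 10), (1, 3), (1, 4), (1, 8), (1, 11), (2, 4), (2, 6),
      (2, 9), (3, 5), (3, 8), (3, 11), (4, 6), (4, 9), (5, 7), (5, 10), (6, 7), (6, 8),
      (7, 8), (9, 10), (9, 11), (10, 11)]) :
    ∀ k : Fin 12, ¬ 5 ≤ (Finset.univ.filter (fun m : Fin 12 =>
      m ≠ k ∧ ((k < m ∧ (k.val, m.val) ∈ L) ∨ (m < k ∧ (m.val, k.val) ∈ L)))).card := by
  subst hL
  decide

/-- In the bicapped pentagonal prism (decahedral axis shell bond graph: poles `0, 11`, rings `1…5` and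
`6…10`, verticals `k ~ k + 5`) exactly the two poles `0` and `11` have `≥ 5` neighbours. -/
theorem ffrTP_deg_dec (L : List (ℕ × ℕ))
    (hL : L = [(0, 1), (0, 2), (0, 3), (0, 4), (0, 5), (1, 2), (1, 5), (1, 6), (2, 3), (2, 7), (3, 4),
      (3, 8), (4, 5), (4, 9), (5, 10), (6, 7), (6, 10), (6, 11), (7, 8), (7, 11), (8, 9),
      (8, 11), (9, 10), (9, 11), (10, 11)]) :
    ∀ k : Fin 12, (5 ≤ (Finset.univ.filter (fun m : Fin 12 =>
      m ≠ k ∧ ((k < m ∧ (k.val, m.val) ∈ L) ∨ (m < k ∧ (m.val, k.val) ∈ L)))).card ↔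
        (k = 0 ∨ k = 11)) := by
  subst hL
  decide

/-- From the `i < j` form of the bond-graph certificate: for distinct labels `k, m`, the shell points
`e k`, `e m` are bonded iff `k` and `m` are adjacent in the edge list. -/
theorem ffrTP_adj_iff {r : ℝ} (L : List (ℕ × ℕ)) {e : Fin 12 → EuclideanSpace ℝ (Fin 3)}
    (hadj : ∀ i j : Fin 12, i < j → (dist (e i) (e j) ≤ r ↔ (i.val, j.val) ∈ L))
    {k m : Fin 12} (hmk : m ≠ k) :
    (dist (e k) (e m) ≤ r ↔ ((k < m ∧ (k.val, m.val) ∈ L) ∨ (m < k ∧ (m.val, k.val) ∈ L))) := by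
  rcases lt_or_gt_of_ne hmk with h | h
  · rw [dist_comm, hadj m k h]
    constructor
    · exact fun hm => Or.inr ⟨h, hm⟩
    · rintro (⟨h', -⟩ | ⟨-, hm⟩)
      · exact absurd h' (not_lt.mpr h.le)
      · exact hm
  · rw [hadj k m h]
    constructor
    · exact fun hm => Or.inl ⟨h, hm⟩
    · rintro (⟨-, hm⟩ | ⟨h', -⟩)
      · exact hm
      · exact absurd h' (not_lt.mpr h.le)

/-- **Core reduction.** If the shell of `y` (points of `Y` other than `y` within `r`) is labelled
injectively by `e : Fin 12 → ℝ³` with bond graph given by the edge list `L`, then the set of shell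
points `v` whose bond `(y, v)` has `≥ 5` common bonded partners is the image under `e` of the labels of
degree `≥ 5`. -/
theorem ffrTP_core {Y : Set (EuclideanSpace ℝ (Fin 3))} {y : EuclideanSpace ℝ (Fin 3)} {r : ℝ}
    (L : List (ℕ × ℕ)) {e : Fin 12 → EuclideanSpace ℝ (Fin 3)} (he : Function.Injective e)
    (hrange : Set.range e = {w ∈ Y | w ≠ y ∧ dist y w ≤ r})
    (hadj : ∀ i j : Fin 12, i < j → (dist (e i) (e j) ≤ r ↔ (i.val, j.val) ∈ L)) :
    {v ∈ Y | v ≠ y ∧ dist y v ≤ r ∧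
        5 ≤ {w ∈ Y | w ≠ y ∧ w ≠ v ∧ dist y w ≤ r ∧ dist v w ≤ r}.ncard} =
      e '' {k : Fin 12 | 5 ≤ (Finset.univ.filter (fun m : Fin 12 =>
        m ≠ k ∧ ((k < m ∧ (k.val, m.val) ∈ L) ∨ (m < k ∧ (m.val, k.val) ∈ L)))).card} := by
  -- the common partners of `(y, e k)` are the images of the labels adjacent to `k`
  have hC : ∀ k : Fin 12, {w ∈ Y | w ≠ y ∧ w ≠ e k ∧ dist y w ≤ r ∧ dist (e k) w ≤ r} =
      e '' {m : Fin 12 | m ≠ k ∧ ((k < m ∧ (k.val, m.val) ∈ L) ∨ (m < k ∧ (m.val, k.val) ∈ L))} := by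
    intro k
    ext w
    constructor
    · rintro ⟨hwY, hwy, hwk, hyw, hkw⟩
      have hwS : w ∈ Set.range e := by
        rw [hrange]
        exact ⟨hwY, hwy, hyw⟩
      obtain ⟨m, rfl⟩ := hwS
      have hmk : m ≠ k := fun h => hwk (by rw [h])
      exact ⟨m, ⟨hmk, (ffrTP_adj_iff L hadj hmk).mp hkw⟩, rfl⟩
    · rintro ⟨m, ⟨hmk, hm⟩, rfl⟩
      have hmS : e m ∈ {w ∈ Y | w ≠ y ∧ dist y w ≤ r} := by
        rw [← hrange]
        exact ⟨m, rfl⟩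
      obtain ⟨hmY, hmy, hym⟩ := hmS
      exact ⟨hmY, hmy, fun h => hmk (he h), hym, (ffrTP_adj_iff L hadj hmk).mpr hm⟩
  -- hence their number is the degree of `k`
  have hCcard : ∀ k : Fin 12,
      {w ∈ Y | w ≠ y ∧ w ≠ e k ∧ dist y w ≤ r ∧ dist (e k) w ≤ r}.ncard =
        (Finset.univ.filter (fun m : Fin 12 =>
          m ≠ k ∧ ((k < m ∧ (k.val, m.val) ∈ L) ∨ (m < k ∧ (m.val, k.val) ∈ L)))).card := by
    intro k
    rw [hC k, Set.ncard_image_of_injective _ he]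
    have hset : {m : Fin 12 | m ≠ k ∧ ((k < m ∧ (k.val, m.val) ∈ L) ∨ (m < k ∧ (m.val, k.val) ∈ L))} =
        ↑(Finset.univ.filter (fun m : Fin 12 =>
          m ≠ k ∧ ((k < m ∧ (k.val, m.val) ∈ L) ∨ (m < k ∧ (m.val, k.val) ∈ L)))) := by
      ext m
      simp only [Set.mem_setOf_eq, Finset.coe_filter, Finset.mem_univ, true_and]
    rw [hset, Set.ncard_coe_finset]
  -- the five-bonds are the images of the labels of degree `≥ 5`
  ext v
  constructor
  · rintro ⟨hvY, hvy, hyv, h5⟩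
    have hvS : v ∈ Set.range e := by
      rw [hrange]
      exact ⟨hvY, hvy, hyv⟩
    obtain ⟨k, rfl⟩ := hvS
    refine ⟨k, ?_, rfl⟩
    rw [hCcard k] at h5
    exact h5
  · rintro ⟨k, hk, rfl⟩
    have hkS : e k ∈ {w ∈ Y | w ≠ y ∧ dist y w ≤ r} := by
      rw [← hrange]
      exact ⟨k, rfl⟩
    obtain ⟨hkY, hky, hyk⟩ := hkS
    refine ⟨hkY, hky, hyk, ?_⟩
    rw [hCcard k]
    exact hk

/-- **Stub N (NO BRANCHING — two poles per five-site; provable now from Stub L).** If every shell bond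
graph is cuboctahedral, anticuboctahedral or prismatic, then at every site the set of FIVE-BONDS (bonds with
`≥ 5` common partners) is empty (fcc/hcp: all shell degrees `4`) or has exactly two elements (dec: the two poles,
labels `0` and `11`, the only degree-`5` vertices of the prism graph): the common partners of `(y, e k)` are the
shell points adjacent to `e k`, counted by the degree of `k` in the edge list. [folklore] -/
theorem stub_ffrTwoPoles :
    ∀ (Y : Set (EuclideanSpace ℝ (Fin 3))) (a : ℝ), 0 < a →
      (∀ y ∈ Y, ({w ∈ Y | w ≠ y ∧ dist y w ≤ a * (1 + 1 / 50)}.ncard = 12 ∧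
        ∀ w ∈ Y, w ≠ y → a * (1 - 1 / 50) ≤ dist y w ∧
          (dist y w ≤ a * (1 + 1 / 50) ∨ a * (63 / 50) ≤ dist y w))) →
      (∀ y ∈ Y, ∀ v ∈ Y, v ≠ y → dist y v ≤ a * (1 + 1 / 50) →
        4 ≤ {w ∈ Y | w ≠ y ∧ w ≠ v ∧ dist y w ≤ a * (1 + 1 / 50) ∧ dist v w ≤ a * (1 + 1 / 50)}.ncard) →
      (∀ y ∈ Y, ∃ e : Fin 12 → EuclideanSpace ℝ (Fin 3), Function.Injective e ∧
        Set.range e = {w ∈ Y | w ≠ y ∧ dist y w ≤ a * (1 + 1 / 50)} ∧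
        ((∀ i j : Fin 12, i < j → (dist (e i) (e j) ≤ a * (1 + 1 / 50) ↔
            (i.val, j.val) ∈ ([(0, 4), (0, 5), (0, 8), (0, 9), (1, 4), (1, 5), (1, 10), (1, 11), (2, 6), (2, 7),
                (2, 8), (2, 9), (3, 6), (3, 7), (3, 10), (3, 11), (4, 8), (4, 10), (5, 9), (5, 11),
                (6, 8), (6, 10), (7, 9), (7, 11)] : List (ℕ × ℕ)))) ∨
          (∀ i j : Fin 12, i < j → (dist (e i) (e j) ≤ a * (1 + 1 / 50) ↔
            (i.val, j.val) ∈ ([(0, 2), (0, 5), (0, 7), (0, 10), (1, 3), (1, 4), (1, 8), (1, 11), (2, 4), (2, 6),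
                (2, 9), (3, 5), (3, 8), (3, 11), (4, 6), (4, 9), (5, 7), (5, 10), (6, 7), (6, 8),
                (7, 8), (9, 10), (9, 11), (10, 11)] : List (ℕ × ℕ)))) ∨
          (∀ i j : Fin 12, i < j → (dist (e i) (e j) ≤ a * (1 + 1 / 50) ↔
            (i.val, j.val) ∈ ([(0, 1), (0, 2), (0, 3), (0, 4), (0, 5), (1, 2), (1, 5), (1, 6), (2, 3), (2, 7), (3, 4),
                (3, 8), (4, 5), (4, 9), (5, 10), (6, 7), (6, 10), (6, 11), (7, 8), (7, 11), (8, 9),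
                (8, 11), (9, 10), (9, 11), (10, 11)] : List (ℕ × ℕ)))))) →
      ∀ y ∈ Y, {v ∈ Y | v ≠ y ∧ dist y v ≤ a * (1 + 1 / 50) ∧
          5 ≤ {w ∈ Y | w ≠ y ∧ w ≠ v ∧ dist y w ≤ a * (1 + 1 / 50) ∧
            dist v w ≤ a * (1 + 1 / 50)}.ncard} = ∅ ∨
        ({v ∈ Y | v ≠ y ∧ dist y v ≤ a * (1 + 1 / 50) ∧
          5 ≤ {w ∈ Y | w ≠ y ∧ w ≠ v ∧ dist y w ≤ a * (1 + 1 / 50) ∧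
            dist v w ≤ a * (1 + 1 / 50)}.ncard}).ncard = 2 := by
  intro Y a _ _ _ hL y hy
  obtain ⟨e, he, hrange, hG⟩ := hL y hy
  rcases hG with h | h | h
  · -- fcc shell: cuboctahedron, `4`-regular
    rw [ffrTP_core _ he hrange h]
    left
    rw [Set.image_eq_empty, Set.eq_empty_iff_forall_notMem]
    intro k hk
    exact ffrTP_deg_fcc _ rfl k hk
  · -- hcp shell: anticuboctahedron, `4`-regular
    rw [ffrTP_core _ he hrange h]
    left
    rw [Set.image_eq_empty, Set.eq_empty_iff_forall_notMem]
    intro k hk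
    exact ffrTP_deg_hcp _ rfl k hk
  · -- decahedral axis shell: bicapped pentagonal prism, poles `0` and `11`
    rw [ffrTP_core _ he hrange h]
    right
    rw [Set.ncard_image_of_injective _ he, Set.ncard_eq_two]
    refine ⟨0, 11, by decide, ?_⟩
    ext k
    rw [Set.mem_setOf_eq, Set.mem_insert_iff, Set.mem_singleton_iff]
    exact ffrTP_deg_dec _ rfl k

end Summit.AtomisticToContinuum.Crystallization.Theorems

end
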